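import Literature.MathematicalPhysics.QuantumFieldTheory.Balaban1983to89.Beta.FluctuationProjection

/-!
# `Balaban1983to89.B5SectBStatements` — T. Bałaban, *Propagators and renormalization transformations for lattice
# gauge theories. I*, Commun. Math. Phys. **95** (1984) 17–40 [Balaban1984PropagatorsI]: the renormalization
# transformation (1.12), its Gaussian value (1.14), Sect. B — the rescaling `S`, the compositions (1.16)–(1.17),
# (1.19) — and the Faddeev–Popov change of gauge (1.22)–(1.23) of Sect. C, TYPED over real lattice fields

statement-level skeleton of published theorems with citation tags; proofs where landed; nothing here is a claim about the Yang–Mills mass gap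

PDF held: `paper:balaban1984-cmp95-propagators-rt-i` (journal page = PDF page + 16).  Pages read for this module AS
IMAGES: renders `run/shared/lean/pub/pub-balaban/b2b-balaban-ref1/pages/1984-cmp95-propagators-rt-I/…-p003-x2.png`
(p. 19), `…-p004-x2.png` (p. 20), `…-p005-x2.png` (p. 21); p. 25 (1.40) from the materialised text and the quotation
in `B5Hk164Transl`.

CITATION HEADER (lean-in-tree rule).  Cell `lit-balaban` (Phase 1 typing by the B5 fold owner), unit `lit-balaban-r02`
gen 2; WHAT IS REPRODUCED = SKELETON rows `B5.Eq1.14` [CLAIM], `B5.Eq1.17` [CLAIM, with (1.16)], `B5.Eq1.19`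
[DEF-by-claim], `B5.Eq1.23` [CLAIM, with (1.22)] of `run/shared/lean/pub/lit-balaban/lit-balaban-r02/ROWS-B5.md` (all
«absent» at SKELETON v3.10), which are statements about ITERATES of the transformation (1.12) composed with the block
averages `Q_k`, `Q′_k` of (1.18)/(1.20) — typed-existing on the torus carrier of the tree's B5 files
(`B5Block118.QvOp/QsOp`, `B5Composition116.QvOp_comp`) — so (1.12) is typed HERE on that carrier (`rtT`, `rt12`) as
their building block.  TWIN CARRIER BY DESIGN (cf. lead ruling G.5-1): the declaration of record of SKELETON row
`B5.Eq1.12` itself is seat p16's `B5Eq112RenormTransf` on the V1 calculus (`LatticeFieldCalculus.bondAvg`/`IsAxial`;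
TAKING 2026-08-21T00:46:43Z, lead ruling G.5-34(c)); this file's `rtT` is the same printed object on the `Tor` carrier
and claims nothing for that row; a bridge between the two carriers is a later knitting item.  Dictionary rows PROVED
here: (1.11)/(1.18) `cplx_Qlin`, (1.13)/(1.20) `cplxS_QsLin`, (1.4)/(1.20) `cplx_gaugeR`, the face-layer lift
`cplx_secFld` (β cell).

WHAT IS PRINTED (verbatim; every display is quoted again in the docstring of the declaration that types it).
* p. 19 [PDF 3]: «… we remove it by introducing Axial (Ax) gauge fixing conditions A(Γ_{y,x}) = 0, x∈B(y), x ≠ y,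
  y∈T_L^{(1)}. If we denote δ_Ax(A) = Π_{y∈T_L^{(1)}} Π_{x∈B(y), x≠y} δ(A(Γ_{y,x})), (1.10)
  (QA)_c = Σ_{x∈B(c₋)} L^{−(d+1)}A([x, x(c)]), δ(B − QA) = Π_{c⊂T_L^{(1)}} δ(B_c − (QA)_c), (1.11)
  then the renormalization transformation T is defined by (Te^{−S})(B) = ∫dA δ(B − QA) δ_Ax(A) e^{−S(A)}. (1.12)»;
  «A result of the integration is obviously a Gaussian density (Te^{−S})(B) = Z^{(0)} exp(−½⟨B, Δ₁B⟩) = Z^{(0)} exp(−S₁(B)).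
  (1.14)».
* p. 20 [PDF 4]: «The density (1.14) is defined on the L-lattice T_L^{(1)} and our final operation is the rescaling
  from this lattice to the unit lattice T₁^{(1)}. The operation of rescaling is denoted by S.»; (1.16), (1.17), (1.18),
  (1.19) and «It is easily seen that Z_{k,Ax} = Z^{(k−1)}·…·Z^{(0)}» (quoted in full at `Eq116`, `Eq117`, `Qk`, `Eq119`).
* p. 21 [PDF 5]: the Faddeev–Popov identity (1.22) and the transformed integral (1.23) (quoted in full at `fp22`,
  `Claim122`, `Eq123`).
* p. 25 [PDF 9], (1.40): «∫dλ δ(Q′_kλ) exp(−(1/2α)‖Δλ‖²) = ∫_{N(Q′_k)} dλ exp(−(1/2α)‖Δλ‖²)» — the paper's own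
  reading of a δ-function of LINEAR constraints as the flat measure of the constraint subspace (used here as the
  MEANING of every «∫dA δ(…)», §1; the same reading is the tree's `B5GaussSectC` («THE CONSTRAINT MEASURE δ(Q′_kλ)dλ is
  typed as the Lebesgue measure of the subspace N(Q′_k) … the first equality of (1.40) taken as a definition»),
  `B5Hk164Transl` §3 for (1.47), and `B9Eq320Gauss`).

WHAT THIS MODULE DOES.
§1 `deltaInt C G ρ B` — «∫dA δ(B − CA) δ_G(A) ρ(A)» for a linear constraint map `C`, a gauge SUBSPACE `G` and a
   density `ρ` on a finite-dimensional real inner-product space: the Bochner integral of `ρ` over the fibre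
   `{A ∈ G : CA = B}` against the Euclidean volume of `N(C) ∩ G` translated to the fibre (Mathlib's `volume` of the
   sub-inner-product-space; `0` on an empty fibre); `deltaInt_eq`: independent of the base point (PROVED, Haar
   translation invariance); `deltaInt_const_mul`.
§2 Sect. A over REAL fields `Fld N = EuclideanSpace ℝ (Tor N × Fin d)` («dA» = its Lebesgue measure) on the torus
   carrier of the tree's B5 files (`B5Prop11Plancherel.Tor`, blocks `B5Block118.bpt`): `Qlin` = (1.11)/(1.18) and
   `QsLin` = (1.13)/(1.20) as `ℝ`-linear maps, with the DICTIONARY `cplx_Qlin : cplx (Qlin A) = QvOp *ᵥ cplx A`,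
   `cplxS_QsLin` (PROVED: the typed-existing complex matrices restricted to real fields); the contour points
   `stairPt`/contour sums `axSum` of (1.7) «A(Γ_{y,x})»; the axial subspace `Ax` (1.10); **`rtT ρ` = the
   renormalization transformation (1.12) of a density `ρ`** and **`rt12` = `(Te^{−S})` verbatim** (unit-lattice action
   (1.5) = `B5Action121.actionS _ 1 1`); `rt12_eq` (the integral at any base point), `rt12_nonneg`.
§2b NON-VACUITY (PROVED): the β cell's face-layer lift (`Beta.FluctuationProjection.Jlift`, `QvOp_Jlift_mulVec`) read on
   real fields, `secFld B` (n·B_μ(y) on the last-digit bonds of each block; dictionary `cplx_secFld`), has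
   `Q(secFld B) = B` (`Qlin_secFld`) and lies in the AXIAL gauge (`secFld_mem_Ax`, new), so every fibre of (1.12) is
   non-empty (`fibre_rt_nonempty`, `Qlin_surjOn_Ax`) and `(Tρ)(B) = ∫_{QA′=0, A′ axial} ρ(secFld B + A′)dA′` for EVERY
   density and every `B` (`rtT_eq`).
§3 `Eq114` — (1.14) as a typed CLAIM (∃ Z^{(0)} > 0, ∃ symmetric Δ₁ with (Te^{−S})(B) = Z^{(0)}e^{−½⟨B,Δ₁B⟩}); `S1`.
§4 the tower `towerM L M j` (level `j` has `L^j M_μ` sites; level 0 = the unit lattice `T₁^{(k)}`), the rescaling of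
   densities `scaleDens` (= S, read through (1.5)), **`iterST k` = `(ST)^k`**, the composites `Qk` (= Q_k read as
   `Q∘⋯∘Q`, p. 20) and `Qsk` (= Q′_k), the multi-level axial subspace `AxAll k` (support of `δ_Ax(Q_{k−1}A)⋯δ_Ax(A)`),
   `actionEta k` = S^η (η = L^{−k}), `rt17 k` = the integral on the right of (1.17); the CLAIMS `Eq117 k` ((1.17):
   `(ST)^k e^{−S} = z^{(k)}·rt17 k`, some z^{(k)} > 0), `Eq116 := Eq117 2` with `iterST_two` displaying (1.16)'s left
   side, `Eq119 k` ((1.19): the iterate is a centred Gaussian `Z_{k,Ax}e^{−½⟨B,Δ_kB⟩}`); consistency lemmas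
   `iterST_one`, `axAll_one`, `qk_one` (k = 1 is (1.12)).
§5 `divSq k` = «⟨∂*A, ∂*A⟩» of (1.21) (tree `B5Action121.divS`), `gaugeR` = «A^λ = A − ∂^ηλ» on real fields with the
   dictionary `cplx_gaugeR` (= tree `gaugeT`, PROVED), **`fp22 k α A` = the Faddeev–Popov integral «∫dλ δ(Q′_kλ)
   exp(−(1/2α)⟨∂*A^λ, ∂*A^λ⟩)»**, `Claim122` (it is ≠ 0), `rt23 k α` = the integral on the right of (1.23), and the
   CLAIM `Eq123 k` ((ST)^k e^{−S} = z′^{(k)}·rt23 k α for every α > 0); `eq123_of_eq117` (bookkeeping).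

HONEST SCOPE.  (i) Every «∫ … δ(…)» is TYPED by the convention of (1.40) (flat measure of the constraint subspace,
translated); the absolute normalisations of the δ-functions — immaterial in the paper, which absorbs them in
«Z^{(0)}», «z^{(k)} a numerical factor», «Z_{k,Ax}» — are those of Mathlib's Euclidean volume on the direction
subspaces, and the typed claims (1.14)/(1.16)/(1.17)/(1.19)/(1.23) quantify those factors existentially (`∃ z > 0`),
exactly as printed.  (ii) `S` is read through (1.5) with ε ↤ L (the only rescaling the paper defines); with this
reading (1.17) holds with z^{(k)} = a power of L^{−(d−2)/2} (not certified here).  (iii) `Q_k`, `Q′_k` are the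
COMPOSITES down the tower (p. 20 «Q(QA) = Q₂A» inside (1.16)); their one-stroke formulas (1.18)/(1.20) are the tree's
`B5Block118.QvOp/QsOp` (two-level identity `B5Composition116.QvOp_comp`; the k-level identification is SKELETON row
B5.Eq1.11-1.18, not this file).  (iv) Nothing of (1.14), (1.16)–(1.17), (1.19), (1.22)–(1.23) is PROVED here: they are
`def … : Prop` statements consumed downstream only as hypotheses until a Phase-2 `theorem …_holds`; the positivity
that makes (1.12) converge is `B5SectAStatements.claimP19_holds` (on the `B6Lemma24Torus` carrier), the Landau-gauge
evaluation (1.47) ⟹ (1.64) is `B5Hk164Transl`, the hierarchical-gauge lemma behind the middle term of (1.23) is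
`B5.HierGauge`.  (v) U = 1 (pure Maxwell/small-field linearisation: the paper's own setting of Sect. 1), every d,
every L ≥ 1, every torus.  Value = typed skeleton rows with kernel-checked dictionaries to the existing carriers; NOT
summit progress.
-/

open scoped BigOperators Matrix
open Finset MeasureTheory

namespace Literature.MathematicalPhysics.QuantumFieldTheory.Balaban1983to89.B5SectBStatements

open B5Prop11Plancherel (Tor fine unitVec)
open B5Block118 (bpt tstep QvOp QsOp)
open B5Action121 (actionS divS gaugeT GradOp)

noncomputable section

/-! ## §1  The δ-functions of LINEAR constraints: `∫dA δ(B − CA) δ_G(A) ρ(A)` as the flat integral over the fibre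

B5's own reading, p. 25 (1.40): «∫dλ δ(Q′_kλ) exp(−(1/2α)‖Δλ‖²) = ∫_{N(Q′_k)} dλ exp(−(1/2α)‖Δλ‖²)» — a product of
δ-functions of linear constraints is the Euclidean (Lebesgue) measure of the constraint subspace, translated to the
fibre; normalisation constants are immaterial in the paper («Z^{(0)}», «z^{(k)} is a numerical factor»). -/

section DeltaAlg

variable {E : Type*} [AddCommGroup E] [Module ℝ E]
variable {F : Type*} [AddCommGroup F] [Module ℝ F]

/-- The directions of the constraint fibres: `N = N(C) ∩ G` (for (1.12): `{A : QA = 0} ∩ {A : A(Γ_{y,x}) = 0}`).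
[cite: Balaban1984PropagatorsI, (1.40) p.25] -/
def dirSpace (C : E →ₗ[ℝ] F) (G : Submodule ℝ E) : Submodule ℝ E := LinearMap.ker C ⊓ G

/-- The fibre over `B`: `{A ∈ G : CA = B}` (for (1.12): the configurations with `QA = B` in the axial gauge).
[cite: Balaban1984PropagatorsI, (1.12) p.19] -/
def fibre (C : E →ₗ[ℝ] F) (G : Submodule ℝ E) (B : F) : Set E := {A | C A = B ∧ A ∈ G}

/-- membership in the fibre. [cite: Balaban1984PropagatorsI, (1.12) p.19] -/
theorem mem_fibre_iff (C : E →ₗ[ℝ] F) (G : Submodule ℝ E) (B : F) (A : E) :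
    A ∈ fibre C G B ↔ C A = B ∧ A ∈ G := Iff.rfl

/-- two points of one fibre differ by a direction. [cite: Balaban1984PropagatorsI, (1.40) p.25] -/
theorem sub_mem_dirSpace {C : E →ₗ[ℝ] F} {G : Submodule ℝ E} {B : F} {A A' : E}
    (hA : A ∈ fibre C G B) (hA' : A' ∈ fibre C G B) : A' - A ∈ dirSpace C G := by
  rcases hA with ⟨hC, hG⟩
  rcases hA' with ⟨hC', hG'⟩
  refine Submodule.mem_inf.mpr ⟨LinearMap.mem_ker.mpr ?_, G.sub_mem hG' hG⟩
  rw [map_sub, hC, hC', sub_self]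

/-- membership in the direction space. [cite: Balaban1984PropagatorsI, (1.40) p.25] -/
theorem mem_dirSpace_iff {C : E →ₗ[ℝ] F} {G : Submodule ℝ E} (v : E) :
    v ∈ dirSpace C G ↔ C v = 0 ∧ v ∈ G := by
  rw [dirSpace, Submodule.mem_inf, LinearMap.mem_ker]

/-- a fibre is the translate of the direction space by any of its points. [cite: Balaban1984PropagatorsI, (1.40) p.25] -/
theorem add_mem_fibre_iff {C : E →ₗ[ℝ] F} {G : Submodule ℝ E} {B : F} {A : E} (hA : A ∈ fibre C G B) (v : E) :
    A + v ∈ fibre C G B ↔ v ∈ dirSpace C G := by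
  rcases hA with ⟨hC, hG⟩
  rw [mem_dirSpace_iff, mem_fibre_iff, map_add, hC]
  constructor
  · rintro ⟨hC', hG'⟩
    refine ⟨by simpa using hC', ?_⟩
    have h := G.sub_mem hG' hG
    rwa [add_sub_cancel_left] at h
  · rintro ⟨hvC, hvG⟩
    exact ⟨by rw [hvC, add_zero], G.add_mem hG hvG⟩

end DeltaAlg

section DeltaInt

variable {E : Type*} [NormedAddCommGroup E] [InnerProductSpace ℝ E] [FiniteDimensional ℝ E]
  [MeasurableSpace E] [BorelSpace E]
variable {F : Type*} [AddCommGroup F] [Module ℝ F]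

open Classical in
/-- **The δ-integral** `∫dA δ(B − CA) δ_G(A) ρ(A)`: the integral of `ρ` over the fibre `{A ∈ G : CA = B}` against the
Euclidean volume of its direction space `N(C) ∩ G` carried to the fibre by translation (B5 (1.40): δ-functions of
linear constraints = the flat measure of the constraint subspace); `0` on an empty fibre.  The base point is
`h.some`; `deltaInt_eq` shows the value does not depend on it. [cite: Balaban1984PropagatorsI, (1.40) p.25] -/
def deltaInt (C : E →ₗ[ℝ] F) (G : Submodule ℝ E) (ρ : E → ℝ) (B : F) : ℝ :=
  if h : (fibre C G B).Nonempty then ∫ v : dirSpace C G, ρ (h.some + (v : E)) else 0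

/-- **Base-point independence**: for ANY point `A` of the fibre, `∫dA′ δ(B − CA′)δ_G(A′)ρ(A′) = ∫_{N(C)∩G} ρ(A + v) dv`
(translation invariance of the Euclidean volume of the subspace). [cite: Balaban1984PropagatorsI, (1.40) p.25] -/
theorem deltaInt_eq {C : E →ₗ[ℝ] F} {G : Submodule ℝ E} (ρ : E → ℝ) {B : F} {A : E} (hA : A ∈ fibre C G B) :
    deltaInt C G ρ B = ∫ v : dirSpace C G, ρ (A + (v : E)) := by
  have hne : (fibre C G B).Nonempty := ⟨A, hA⟩
  rw [deltaInt, dif_pos hne]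
  set k₀ : dirSpace C G := ⟨hne.some - A, sub_mem_dirSpace hA hne.some_mem⟩ with hk₀
  have h : ∀ v : dirSpace C G, hne.some + (v : E) = A + ((k₀ + v : dirSpace C G) : E) := by
    intro v
    simp only [hk₀, Submodule.coe_add]
    abel
  simp_rw [h]
  exact integral_add_left_eq_self (μ := (volume : Measure (dirSpace C G)))
    (fun v : dirSpace C G => ρ (A + (v : E))) k₀

/-- on an empty fibre the δ-integral is `0` (never the case for (1.12): `fibre_rt_nonempty`, §2b).
[cite: Balaban1984PropagatorsI, (1.40) p.25] -/
theorem deltaInt_of_isEmpty {C : E →ₗ[ℝ] F} {G : Submodule ℝ E} (ρ : E → ℝ) {B : F}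
    (h : ¬ (fibre C G B).Nonempty) : deltaInt C G ρ B = 0 := by
  rw [deltaInt, dif_neg h]

/-- linearity in the density: constants come out (used for the normalisation factors `z^{(k)}`).
[cite: Balaban1984PropagatorsI, (1.40) p.25] -/
theorem deltaInt_const_mul (C : E →ₗ[ℝ] F) (G : Submodule ℝ E) (c : ℝ) (ρ : E → ℝ) (B : F) :
    deltaInt C G (fun A => c * ρ A) B = c * deltaInt C G ρ B := by
  unfold deltaInt
  by_cases h : (fibre C G B).Nonempty
  · rw [dif_pos h, dif_pos h, integral_const_mul]
  · rw [dif_neg h, dif_neg h, mul_zero]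

end DeltaInt

/-! ## §2  Sect. A on REAL fields: `Q` (1.11)/(1.18), `Q′` (1.13)/(1.20), the contours `Γ_{y,x}` (1.7), the axial
gauge (1.10), and THE RENORMALIZATION TRANSFORMATION (1.12) -/

section OneStep

variable {d : ℕ}

/-- Real vector fields on the torus with `N_μ` sites in direction `μ`: `A (x, μ) = A_μ(x) = A_{⟨x, x+ηe_μ⟩}` ((1.1):
«A_{⟨x,x+εe_μ⟩} = A_μ(x)»), with the Euclidean structure `⟨A, A′⟩ = Σ_{x,μ} A_μ(x)A′_μ(x)` (the scalar product of
(1.21) without its weight `η^d`) — hence with the Lebesgue measure «dA». [cite: Balaban1984PropagatorsI, (1.1) p.18] -/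
abbrev Fld (N : Fin d → ℕ) : Type := EuclideanSpace ℝ (Tor N × Fin d)

/-- Real scalar functions `λ : T → ℝ` (gauge functions), Euclidean structure `Σ_x λ(x)λ′(x)` — hence «dλ».
[cite: Balaban1984PropagatorsI, (1.4) p.18] -/
abbrev Scl (N : Fin d → ℕ) : Type := EuclideanSpace ℝ (Tor N)

/-- a real field read as a complex one (the tree's B5 operators `QvOp`, `actionS`, `divS`, … act on `… → ℂ`).
[cite: Balaban1984PropagatorsI, (1.1) p.18] -/
def cplx {N : Fin d → ℕ} (A : Fld N) : Tor N × Fin d → ℂ := fun i => ((A i : ℝ) : ℂ)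

/-- a real scalar function read as a complex one. [cite: Balaban1984PropagatorsI, (1.4) p.18] -/
def cplxS {N : Fin d → ℕ} (l : Scl N) : Tor N → ℂ := fun x => ((l x : ℝ) : ℂ)

variable (n : ℕ) (M : Fin d → ℕ)

/-- **(1.11)/(1.18)** «(Q_kA)_b = Σ_{x∈B^k(b₋)} η^{d+1}A([x, x(b)])», `b = ⟨y, y + e_μ⟩`, `x(b) = x + e_μ`, `η = n⁻¹`
(`n = L^k` fine sites per coarse site; (1.11) is the case `n = L`: «(QA)_c = Σ_{x∈B(c₋)} L^{−(d+1)}A([x, x(c)])»), as a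
function of a real field: `n^{−(d+1)} Σ_{j} Σ_{t<n} A_μ(ny + j + tηe_μ)`. [cite: Balaban1984PropagatorsI, (1.11) p.19] -/
def qFun (A : Tor (fine n M) × Fin d → ℝ) (b : Tor M × Fin d) : ℝ :=
  1 / (n : ℝ) ^ (d + 1) * ∑ j : Fin d → Fin n, ∑ t : Fin n, A (bpt n M b.1 j + tstep (fine n M) b.2 t, b.2)

/-- **The averaging operator `Q` of (1.11) (= `Q_k` of (1.18) for `n = L^k`) as an `ℝ`-linear map** from real fields on
`T_η` to real fields on `T₁^{(k)}`. [cite: Balaban1984PropagatorsI, (1.11) p.19] -/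
def Qlin : Fld (fine n M) →ₗ[ℝ] Fld M where
  toFun A := WithLp.toLp 2 (qFun n M A)
  map_add' A A' := by
    ext b
    simp only [PiLp.add_apply, qFun, Finset.sum_add_distrib, mul_add]
  map_smul' c A := by
    ext b
    simp only [PiLp.smul_apply, qFun, smul_eq_mul, RingHom.id_apply, Finset.mul_sum]
    refine Finset.sum_congr rfl fun j _ => Finset.sum_congr rfl fun t _ => ?_
    ring

/-- `(QA)_b` is the printed sum. [cite: Balaban1984PropagatorsI, (1.11) p.19] -/
theorem Qlin_apply (A : Fld (fine n M)) (b : Tor M × Fin d) : Qlin n M A b = qFun n M A b := rfl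

/-- DICTIONARY: on real fields `Qlin` IS the tree's (complex) matrix `B5Block118.QvOp` of (1.18).
[cite: Balaban1984PropagatorsI, (1.18) p.20] -/
theorem cplx_Qlin [NeZero n] [∀ μ, NeZero (M μ)] (A : Fld (fine n M)) : cplx (Qlin n M A) = QvOp n M *ᵥ cplx A := by
  funext b
  obtain ⟨y, μ⟩ := b
  rw [B5Block118.QvOp_mulVec]
  simp only [cplx, Qlin_apply, qFun, B5Block118.lineSum]
  push_cast
  rfl

/-- **(1.13)/(1.20)** «(Q′_kλ)(y) = Σ_{x∈B^k(y)} η^dλ(x)» (for `n = L`: «(Q′λ)» of (1.13)) as a function of a real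
scalar function. [cite: Balaban1984PropagatorsI, (1.20) p.20] -/
def qsFun (l : Tor (fine n M) → ℝ) (y : Tor M) : ℝ := 1 / (n : ℝ) ^ d * ∑ j : Fin d → Fin n, l (bpt n M y j)

/-- **The scalar block average `Q′` of (1.13) (= `Q′_k` of (1.20) for `n = L^k`) as an `ℝ`-linear map.**
[cite: Balaban1984PropagatorsI, (1.20) p.20] -/
def QsLin : Scl (fine n M) →ₗ[ℝ] Scl M where
  toFun l := WithLp.toLp 2 (qsFun n M l)
  map_add' l l' := by
    ext y
    simp only [PiLp.add_apply, qsFun, Finset.sum_add_distrib, mul_add]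
  map_smul' c l := by
    ext y
    simp only [PiLp.smul_apply, qsFun, smul_eq_mul, RingHom.id_apply, Finset.mul_sum]
    refine Finset.sum_congr rfl fun j _ => ?_
    ring

/-- `(Q′λ)(y)` is the printed sum. [cite: Balaban1984PropagatorsI, (1.20) p.20] -/
theorem QsLin_apply (l : Scl (fine n M)) (y : Tor M) : QsLin n M l y = qsFun n M l y := rfl

/-- DICTIONARY: on real functions `QsLin` IS the tree's matrix `B5Block118.QsOp` of (1.20).
[cite: Balaban1984PropagatorsI, (1.20) p.20] -/
theorem cplxS_QsLin [NeZero n] [∀ μ, NeZero (M μ)] (l : Scl (fine n M)) : cplxS (QsLin n M l) = QsOp n M *ᵥ cplxS l := by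
  funext y
  rw [B5Block118.QsOp_mulVec]
  simp only [cplxS, QsLin_apply, qsFun]
  push_cast
  rfl

variable [NeZero n]

/-- **(1.7)** the points of the contour `Γ_{y,x}`, `x = ny + j ∈ B^k(y)`: «Γ_{y,x} = [y,(y₁, …, y_{d−1}, x_d)] ∪ … ∪
[(y₁, …, y_μ, x_{μ+1}, …, x_d), (y₁, …, x_μ, x_{μ+1}, …, x_d)] ∪ … ∪ [(y₁, x₂, …, x_d), x]» — the LAST coordinate is
moved first; while coordinate `ν` is moved, the coordinates `> ν` are already at `x`, those `< ν` still at `y`: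
the block offset after `t` steps in direction `ν`. [cite: Balaban1984PropagatorsI, (1.7) p.18] -/
def stairPt (j : Fin d → Fin n) (ν : Fin d) (t : Fin n) : Fin d → Fin n :=
  fun μ => if ν < μ then j μ else if μ = ν then t else 0

/-- **`A(Γ_{y,x})`** for `x = ny + j`: «A(Γ) = Σ_{b⊂Γ} A_b» (p. 19) along the contour (1.7), oriented «with initial
point y and final point x» — the bonds `⟨p, p + ηe_ν⟩`, `p = ny + stairPt j ν t`, `t < j_ν`.
[cite: Balaban1984PropagatorsI, (1.7) p.18] -/
def axSum (A : Tor (fine n M) × Fin d → ℝ) (y : Tor M) (j : Fin d → Fin n) : ℝ :=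
  ∑ ν : Fin d, ∑ t : Fin n, (if (t : ℕ) < (j ν : ℕ) then (1 : ℝ) else 0) * A (bpt n M y (stairPt n j ν t), ν)

/-- `A ↦ A(Γ_{y,x})` as a linear functional on real fields. [cite: Balaban1984PropagatorsI, (1.7) p.18] -/
def axFun (y : Tor M) (j : Fin d → Fin n) : Fld (fine n M) →ₗ[ℝ] ℝ where
  toFun A := axSum n M A y j
  map_add' A A' := by
    simp only [axSum, WithLp.ofLp_add, Pi.add_apply, mul_add, Finset.sum_add_distrib]
  map_smul' c A := by
    simp only [axSum, WithLp.ofLp_smul, Pi.smul_apply, smul_eq_mul, RingHom.id_apply, Finset.mul_sum]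
    refine Finset.sum_congr rfl fun ν _ => Finset.sum_congr rfl fun t _ => ?_
    ring

/-- `axFun y j A = A(Γ_{y, ny+j})`. [cite: Balaban1984PropagatorsI, (1.7) p.18] -/
theorem axFun_apply (y : Tor M) (j : Fin d → Fin n) (A : Fld (fine n M)) : axFun n M y j A = axSum n M A y j := rfl

/-- **(1.10) the axial gauge** «Axial (Ax) gauge fixing conditions A(Γ_{y,x}) = 0, x∈B(y), x ≠ y, y∈T_L^{(1)}.
If we denote δ_Ax(A) = Π_{y∈T_L^{(1)}} Π_{x∈B(y), x≠y} δ(A(Γ_{y,x})), (1.10)» — the SUBSPACE on which `δ_Ax` is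
concentrated: `{A : A(Γ_{y,x}) = 0 for all y and all x ∈ B(y)}` (the condition at `x = y` is empty: `A(Γ_{y,y}) = 0`,
`axSum_zero_offset`). [cite: Balaban1984PropagatorsI, (1.10) p.19] -/
def Ax : Submodule ℝ (Fld (fine n M)) := ⨅ y : Tor M, ⨅ j : Fin d → Fin n, LinearMap.ker (axFun n M y j)

/-- membership in the axial subspace = all contour sums vanish. [cite: Balaban1984PropagatorsI, (1.10) p.19] -/
theorem mem_Ax_iff (A : Fld (fine n M)) : A ∈ Ax n M ↔ ∀ y j, axSum n M A y j = 0 := by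
  simp only [Ax, Submodule.mem_iInf, LinearMap.mem_ker, axFun_apply]

/-- the empty contour: `A(Γ_{y,y}) = 0` («x ≠ y» in (1.10) loses nothing). [cite: Balaban1984PropagatorsI, (1.10) p.19] -/
theorem axSum_zero_offset (A : Tor (fine n M) × Fin d → ℝ) (y : Tor M) :
    axSum n M A y (fun _ => ⟨0, Nat.pos_of_ne_zero (NeZero.ne n)⟩) = 0 := by
  unfold axSum
  refine Finset.sum_eq_zero fun ν _ => Finset.sum_eq_zero fun t _ => ?_
  simp

variable [hM : ∀ μ, NeZero (M μ)]

/-- **(1.12) THE RENORMALIZATION TRANSFORMATION `T`** on densities: «then the renormalization transformation T is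
defined by (Te^{−S})(B) = ∫dA δ(B − QA) δ_Ax(A) e^{−S(A)}. (1.12)» — for a density `ρ` of the fine field,
`(Tρ)(B) = ∫dA δ(B − QA) δ_Ax(A) ρ(A)`: the δ-integral (§1) of `ρ` over the fibre `{A : QA = B, A(Γ_{y,x}) = 0}`.
General `n` (= `L` in (1.12); `= L^k` with the one-stroke `Q_k` of (1.18)).  Torus-carrier twin of the row's
declaration of record (seat p16, `B5Eq112RenormTransf`, V1 calculus); used below as the building block of `(ST)^k`.
[cite: Balaban1984PropagatorsI, (1.12) p.19] -/
def rtT (ρ : Fld (fine n M) → ℝ) : Fld M → ℝ := deltaInt (Qlin n M) (Ax n M) ρ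

/-- the unit-lattice action «S(A) = ½ Σ_{p⊂T₁} |(∂A)(p)|²» (1.5) of a REAL field (the tree's `B5Action121.actionS`
at lattice factor 1 and weight 1, = `B5SectAStatements.action15`). [cite: Balaban1984PropagatorsI, (1.5) p.18] -/
def action1 {N : Fin d → ℕ} [∀ μ, NeZero (N μ)] (A : Fld N) : ℝ := actionS N 1 1 (cplx A)

/-- **(1.12) verbatim**: `(Te^{−S})(B) = ∫dA δ(B − QA) δ_Ax(A) e^{−S(A)}`, the renormalization transformation applied
to the Gibbs density of the unit-lattice action (1.5) — a real function of the block field `B` on `T_L^{(1)}`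
(fine torus `T₁` with `n·M_μ` sites, blocks of side `n = L`). [cite: Balaban1984PropagatorsI, (1.12) p.19] -/
def rt12 : Fld M → ℝ := rtT n M fun A => Real.exp (-action1 A)

/-- (1.12) unfolded at any point `A₀` of the fibre: `(Te^{−S})(B) = ∫_{QA′=0, A′ axial} e^{−S(A₀ + A′)} dA′`.
[cite: Balaban1984PropagatorsI, (1.12) p.19] -/
theorem rt12_eq (B : Fld M) (A₀ : Fld (fine n M)) (hQ : Qlin n M A₀ = B) (hAx : A₀ ∈ Ax n M) :
    rt12 n M B = ∫ v : dirSpace (Qlin n M) (Ax n M), Real.exp (-action1 (A₀ + (v : Fld (fine n M)))) := by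
  unfold rt12 rtT
  exact deltaInt_eq _ ⟨hQ, hAx⟩

/-- (1.12) is non-negative (a Gaussian-type integral of a positive density). [cite: Balaban1984PropagatorsI, (1.12) p.19] -/
theorem rt12_nonneg (B : Fld M) : 0 ≤ rt12 n M B := by
  unfold rt12 rtT deltaInt
  split_ifs
  · exact integral_nonneg fun v => (Real.exp_pos _).le
  · exact le_rfl

end OneStep

/-! ### §2b  Non-vacuity of (1.12): every block field `B` is the average `QA` of an axial-gauge field `A`

The face-layer lift of the β cell (`Beta.FluctuationProjection.Jlift`: `n·B_μ(y)` on the bonds `⟨x, x + ηe_μ⟩` of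
`B^k(y)` whose `μ`-digit is the last one, `n − 1`, zero elsewhere; `QvOp_Jlift_mulVec`: `Q·(JB) = B`) restricted to
REAL fields is moreover in the AXIAL gauge — no contour `Γ_{y,x}` of (1.7) contains a last-digit bond.  Hence the
fibre of (1.12) is never empty and `rtT`/`rt12` are honest integrals for every `B`. -/

section NonVacuity

open Beta.FluctuationProjection (digitOf digitOf_bpt Jlift Jlift_mulVec QvOp_Jlift_mulVec)

variable {d : ℕ} (n : ℕ) [NeZero n] (M : Fin d → ℕ) [hM : ∀ μ, NeZero (M μ)]

omit hM in
/-- `cplx` is injective (a real field is determined by its complexification). [cite: Balaban1984PropagatorsI, (1.1) p.18] -/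
theorem cplx_injective {N : Fin d → ℕ} : Function.Injective (cplx (N := N)) := by
  intro A A' h
  ext i
  exact Complex.ofReal_injective (congrFun h i)

/-- **The axial section of `Q`** on real fields: the β cell's face-layer lift `Jlift` — `n·B_μ(y)` on the bonds of
`B^k(y)` in direction `μ` with last `μ`-digit `n − 1`, zero on all other bonds. [cite: Balaban1984PropagatorsI, (1.12) p.19] -/
def secFld (B : Fld M) : Fld (fine n M) :=
  WithLp.toLp 2 fun i =>
    if ((digitOf n M i.1 i.2 : ℕ)) = n - 1 then (n : ℝ) * B (B5Blocks16.blockOf n M i.1, i.2) else 0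

/-- value of the section on a bond written in block coordinates. [cite: Balaban1984PropagatorsI, (1.12) p.19] -/
theorem secFld_bpt (B : Fld M) (y : Tor M) (j : Fin d → Fin n) (μ : Fin d) :
    secFld n M B (bpt n M y j, μ) = if ((j μ : ℕ)) = n - 1 then (n : ℝ) * B (y, μ) else 0 := by
  simp only [secFld, PiLp.toLp_apply, digitOf_bpt, B5Blocks16.blockOf_bpt]

/-- DICTIONARY: the real section IS the β cell's complex lift `Jlift` on complexified fields.
[cite: Balaban1984PropagatorsI, (1.12) p.19] -/
theorem cplx_secFld (B : Fld M) : cplx (secFld n M B) = Jlift n M *ᵥ cplx B := by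
  funext i
  obtain ⟨x, ν⟩ := i
  rw [Jlift_mulVec]
  simp only [cplx, secFld, PiLp.toLp_apply]
  split_ifs <;> push_cast <;> rfl

/-- **`Q(secFld B) = B`** (from `Beta.FluctuationProjection.QvOp_Jlift_mulVec` through the dictionaries).
[cite: Balaban1984PropagatorsI, (1.12) p.19] -/
theorem Qlin_secFld (B : Fld M) : Qlin n M (secFld n M B) = B :=
  cplx_injective (by rw [cplx_Qlin, cplx_secFld, QvOp_Jlift_mulVec])

omit hM in
/-- the moving coordinate of a contour point is the step counter. [cite: Balaban1984PropagatorsI, (1.7) p.18] -/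
theorem stairPt_self (j : Fin d → Fin n) (ν : Fin d) (t : Fin n) : stairPt n j ν t ν = t := by
  simp [stairPt]

/-- **`secFld B` is in the axial gauge**: no contour `Γ_{y,x}` contains a last-digit bond (its bonds in direction `ν`
start at `ν`-digits `t < j_ν ≤ n − 1`). [cite: Balaban1984PropagatorsI, (1.10) p.19] -/
theorem secFld_mem_Ax (B : Fld M) : secFld n M B ∈ Ax n M := by
  rw [mem_Ax_iff]
  intro y j
  unfold axSum
  refine Finset.sum_eq_zero fun ν _ => Finset.sum_eq_zero fun t _ => ?_
  by_cases ht : (t : ℕ) < (j ν : ℕ)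
  · rw [if_pos ht, one_mul, secFld_bpt, stairPt_self, if_neg]
    have := (j ν).is_lt
    omega
  · rw [if_neg ht, zero_mul]

/-- **Non-vacuity of (1.12)**: for every block field `B` the fibre `{A : QA = B, A axial}` is non-empty.
[cite: Balaban1984PropagatorsI, (1.12) p.19] -/
theorem fibre_rt_nonempty (B : Fld M) : (fibre (Qlin n M) (Ax n M) B).Nonempty :=
  ⟨secFld n M B, Qlin_secFld n M B, secFld_mem_Ax n M B⟩

/-- `Q` maps the axial subspace ONTO the block fields («fixing the average» is a constraint for every `B`).
[cite: Balaban1984PropagatorsI, (1.12) p.19] -/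
theorem Qlin_surjOn_Ax : Set.SurjOn (Qlin n M) (Ax n M) Set.univ :=
  fun B _ => ⟨secFld n M B, secFld_mem_Ax n M B, Qlin_secFld n M B⟩

/-- (1.12) for ANY density is an honest fibre integral: `(Tρ)(B) = ∫_{QA′ = 0, A′ axial} ρ(secFld B + A′) dA′`.
[cite: Balaban1984PropagatorsI, (1.12) p.19] -/
theorem rtT_eq (ρ : Fld (fine n M) → ℝ) (B : Fld M) :
    rtT n M ρ B = ∫ v : dirSpace (Qlin n M) (Ax n M), ρ (secFld n M B + (v : Fld (fine n M))) :=
  deltaInt_eq ρ ⟨Qlin_secFld n M B, secFld_mem_Ax n M B⟩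

end NonVacuity

/-! ## §3  (1.14): «A result of the integration is obviously a Gaussian density» — typed CLAIM (proof = Phase 2) -/

section Eq114

variable {d : ℕ} (n : ℕ) [NeZero n] (M : Fin d → ℕ) [hM : ∀ μ, NeZero (M μ)]

/-- «S₁(B)» of (1.14): the quadratic form `½⟨B, Δ₁B⟩` of an operator `Δ₁` on the block fields (Euclidean scalar
product of `Fld M`). [cite: Balaban1984PropagatorsI, (1.14) p.19] -/
def S1 (Δ₁ : Fld M →ₗ[ℝ] Fld M) (B : Fld M) : ℝ := 1 / 2 * inner ℝ B (Δ₁ B)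

/-- **(1.14) CLAIM** p. 19 [PDF 3], verbatim: *"The integral in (1.12) is obviously a Gaussian integral. … A result of
the integration is obviously a Gaussian density (Te^{−S})(B) = Z^{(0)} exp(−½⟨B, Δ₁B⟩) = Z^{(0)} exp(−S₁(B)). (1.14)"*
— typed reading: there are a normalisation factor `Z^{(0)} > 0` and a symmetric linear operator `Δ₁` on the fields of
`T_L^{(1)}` such that the function (1.12) is `B ↦ Z^{(0)}exp(−½⟨B, Δ₁B⟩)`.  (This DEFINES `Δ₁`; the tree's explicit
momentum formula for `⟨B, Δ_kB⟩` is (1.66), `B5Bounds167Lattice.formDk`, whose identification with (1.14)/(1.19) is not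
certified.)  Proof deferred (Gaussian integration over the fibre + the positivity claim of p. 19,
`B5SectAStatements.claimP19_holds`). [cite: Balaban1984PropagatorsI, (1.14) p.19] -/
def Eq114 : Prop :=
  ∃ Z0 : ℝ, 0 < Z0 ∧ ∃ Δ₁ : Fld M →ₗ[ℝ] Fld M,
    (∀ B B' : Fld M, inner ℝ (Δ₁ B) B' = inner ℝ B (Δ₁ B')) ∧
      ∀ B : Fld M, rt12 n M B = Z0 * Real.exp (-S1 M Δ₁ B)

end Eq114

/-! ## §4  Sect. B: the rescaling `S`, compositions `(ST)^k` (1.16)–(1.17) over the tower of lattices, (1.19) -/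

section Tower

variable {d : ℕ} (L : ℕ) (M : Fin d → ℕ)

/-- The tower of tori behind (1.16)–(1.17): level `0` is the unit lattice `T₁^{(k)}` (periods `M`), level `j + 1`
refines level `j` by the factor `L` («Q₂ is defined as Q only with the number L replaced by L² in all
definitions»): `towerM j` has `L^j·M_μ` sites in direction `μ`. [cite: Balaban1984PropagatorsI, (1.16) p.20] -/
def towerM : ℕ → Fin d → ℕ
  | 0 => M
  | j + 1 => fine L (towerM j)

/-- `towerM (j+1) = fine L (towerM j)` (definitional). [cite: Balaban1984PropagatorsI, (1.16) p.20] -/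
theorem towerM_succ (j : ℕ) : towerM L M (j + 1) = fine L (towerM L M j) := rfl

/-- `towerM 0 = M`. [cite: Balaban1984PropagatorsI, (1.16) p.20] -/
theorem towerM_zero : towerM L M 0 = M := rfl

/-- the periods of the tower are positive. [cite: Balaban1984PropagatorsI, (1.16) p.20] -/
theorem towerM_ne_zero [NeZero L] [hM : ∀ μ, NeZero (M μ)] : ∀ (j : ℕ) (μ : Fin d), towerM L M j μ ≠ 0
  | 0, μ => (hM μ).ne
  | j + 1, μ => mul_ne_zero (NeZero.ne L) (towerM_ne_zero j μ)

/-- every level of the tower is a genuine (finite, non-degenerate) torus. [cite: Balaban1984PropagatorsI, (1.16) p.20] -/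
instance towerM_neZero [NeZero L] [∀ μ, NeZero (M μ)] (j : ℕ) (μ : Fin d) : NeZero (towerM L M j μ) :=
  ⟨towerM_ne_zero L M j μ⟩

/-- **The rescaling `S`** (p. 20: *"The density (1.14) is defined on the L-lattice T_L^{(1)} and our final operation is
the rescaling from this lattice to the unit lattice T₁^{(1)}. The operation of rescaling is denoted by S."*), read
through (1.5) «A_μ(εx) = ε^{−(d−2)/2}A_μ(x)» with ε ↤ the ratio of spacings: the unit-lattice field `B′` and the
L-lattice field `B` on the same sites are related by `B = L^{−(d−2)/2}B′`, so on densities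
`(Sg)(B′) = g(L^{−(d−2)/2}·B′)`. [cite: Balaban1984PropagatorsI, (1.5) p.18] -/
def scaleDens {N : Fin d → ℕ} (g : Fld N → ℝ) : Fld N → ℝ :=
  fun B => g (((L : ℝ) ^ (-(((d : ℝ) - 2) / 2))) • B)

variable [NeZero L] [hM : ∀ μ, NeZero (M μ)]

/-- **`(ST)^k`**: the k-fold composition of "renormalization transformation (1.12), then rescaling" applied to a
density of the finest field (level `k` of the tower), producing a density of the unit-lattice field `B` on `T₁^{(k)}`
— the left-hand side of (1.16) (`k = 2`) and (1.17). [cite: Balaban1984PropagatorsI, (1.17) p.20] -/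
def iterST : (k : ℕ) → (Fld (towerM L M k) → ℝ) → (Fld M → ℝ)
  | 0 => fun ρ => ρ
  | k + 1 => fun ρ => iterST k (scaleDens L (rtT L (towerM L M k) ρ))

/-- **`Q_k` as the composite `Q ∘ ⋯ ∘ Q`** down the tower (p. 20: *"Q₂ is defined as Q only with the number L
replaced by L² in all definitions"*, and (1.16) uses `∫dAδ(C − QB)δ(B − QA)(…) = δ(C − Q₂A)(…)`, i.e. `Q(QA) = Q₂A`;
the one-stroke formula (1.18) is the tree's `B5Block118.QvOp (L^k)`, the two-level identity `Q∘Q_{k−1} = Q_k` is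
`B5Composition116.QvOp_comp`). [cite: Balaban1984PropagatorsI, (1.18) p.20] -/
def Qk : (k : ℕ) → (Fld (towerM L M k) →ₗ[ℝ] Fld M)
  | 0 => LinearMap.id
  | k + 1 => (Qk k) ∘ₗ (Qlin L (towerM L M k))

/-- **`Q′_k` as the composite** of the scalar block averages (1.20) down the tower.
[cite: Balaban1984PropagatorsI, (1.20) p.20] -/
def Qsk : (k : ℕ) → (Scl (towerM L M k) →ₗ[ℝ] Scl M)
  | 0 => LinearMap.id
  | k + 1 => (Qsk k) ∘ₗ (QsLin L (towerM L M k))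

/-- **The support of `δ_Ax(Q_{k−1}A)·…·δ_Ax(A)`** in (1.17): the finest field `A` (level `k`) is in the axial gauge of
its L-blocks, and so are its successive averages `QA, Q(QA), …, Q_{k−1}A` (levels `k−1, …, 1`); no condition on
`Q_kA = B` (level 0). [cite: Balaban1984PropagatorsI, (1.17) p.20] -/
def AxAll : (k : ℕ) → Submodule ℝ (Fld (towerM L M k))
  | 0 => ⊤
  | k + 1 => Ax L (towerM L M k) ⊓ (AxAll k).comap (Qlin L (towerM L M k))

/-- `η = L^{−k}`. [cite: Balaban1984PropagatorsI, (1.18) p.20] -/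
def eta (k : ℕ) : ℝ := ((L : ℝ) ^ k)⁻¹

/-- the η-lattice action «S^η(A)» of (1.17): (1.3) with lattice factor `η⁻¹ = L^k` in (1.2) and plaquette weight
`η^d`, of a real field on level `k` (the tree's `B5Action121.actionS`). [cite: Balaban1984PropagatorsI, (1.3) p.18] -/
def actionEta (k : ℕ) (A : Fld (towerM L M k)) : ℝ :=
  actionS (towerM L M k) ((L : ℂ) ^ k) (eta L k ^ d) (cplx A)

/-- **The right-hand side of (1.17)** without its numerical factor: «∫dA δ(B − Q_kA) δ_Ax(Q_{k−1}A)·…·δ_Ax(A)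
e^{−S^η(A)}» — the δ-integral of `e^{−S^η}` over `{A : Q_kA = B, A and all Q_jA (j < k) axial}`.
[cite: Balaban1984PropagatorsI, (1.17) p.20] -/
def rt17 (k : ℕ) : Fld M → ℝ := deltaInt (Qk L M k) (AxAll L M k) fun A => Real.exp (-actionEta L M k A)

/-- **(1.17) CLAIM** p. 20 [PDF 4], verbatim: *"It is easily seen that a composition of k transformations is given by
((ST)^k e^{−S})(B) = z^{(k)} ∫dA δ(B − Q_kA) δ_Ax(Q_{k−1}A)·…·δ_Ax(A) e^{−S^η(A)}, (1.17)"* (z^{(k)} *"a numerical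
factor coming from scaling transformations"*) — typed reading over the tower: `(ST)^k` (`iterST`) applied to the Gibbs
density `e^{−S(A)}` of the unit-lattice action (1.5) on the finest level equals `z^{(k)}·rt17 k` for a constant
`z^{(k)} > 0`, `Q_k` read as the composite (see `Qk`). Proof deferred. [cite: Balaban1984PropagatorsI, (1.17) p.20] -/
def Eq117 (k : ℕ) : Prop :=
  ∃ z : ℝ, 0 < z ∧ ∀ B : Fld M, iterST L M k (fun A => Real.exp (-action1 A)) B = z * rt17 L M k B

/-- (1.16) is the case `k = 2` of `iterST`, verbatim in shape: `((ST)²e^{−S})(C) = S[∫dB δ(C − QB)δ_Ax(B) S[∫dA δ(B −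
QA)δ_Ax(A) exp(−S(A))]]`. [cite: Balaban1984PropagatorsI, (1.16) p.20] -/
theorem iterST_two (ρ : Fld (towerM L M 2) → ℝ) :
    iterST L M 2 ρ = scaleDens L (rtT L M (scaleDens L (rtT L (fine L M) ρ))) := rfl

/-- **(1.16) CLAIM** p. 20 [PDF 4], verbatim: *"A composition of two transformations is easy to calculate:
((ST)²e^{−S})(C) = z^{(2)}∫dB δ(C − QB)δ_Ax(B)∫dA δ(B − QA)δ_Ax(A) exp(−S^{L^{−2}}(A)) = z^{(2)}∫dA(∫dAδ(C − QB)δ(B −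
QA)δ_Ax(B))δ_Ax(A) exp(−S^{L^{−2}}(A)) = z^{(2)}∫dA δ(C − Q₂A)δ_Ax(QA)δ_Ax(A)exp(−S^{L^{−2}}(A)), (1.16) where z^{(2)} is
a numerical factor coming from scaling transformations and Q₂ is defined as Q only with the number L replaced by L² in
all definitions."* — typed as `Eq117` at `k = 2` (`Q₂` read as `Q∘Q`). [cite: Balaban1984PropagatorsI, (1.16) p.20] -/
def Eq116 : Prop := Eq117 L M 2

/-- (1.16) IS (1.17) at k = 2. [cite: Balaban1984PropagatorsI, (1.16) p.20] -/
theorem eq116_iff : Eq116 L M ↔ Eq117 L M 2 := Iff.rfl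

/-- **(1.19) DEFINITION-BY-CLAIM** p. 20 [PDF 4], verbatim: *"We define ((ST)^k e^{−S})(B) = Z_{k,Ax} exp(−½⟨B, Δ_kB⟩).
(1.19) It is easily seen that Z_{k,Ax} = Z^{(k−1)}·…·Z^{(0)}, where Z^{(j)} is a normalization factor connected with
j + 1 integration."* — typed reading: the k-fold iterate is a centred Gaussian density, i.e. there are `Z_{k,Ax} > 0`
and a symmetric operator `Δ_k` on the unit-lattice fields with `((ST)^k e^{−S})(B) = Z_{k,Ax}exp(−½⟨B, Δ_kB⟩)` for
every `B` (this DEFINES `Δ_k`; cf. (1.65)/(1.66) for the formula the tree types, `B5Bounds167Lattice.formDk`).  The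
product formula for `Z_{k,Ax}` is not separately typed.  Proof deferred. [cite: Balaban1984PropagatorsI, (1.19) p.20] -/
def Eq119 (k : ℕ) : Prop :=
  ∃ Z : ℝ, 0 < Z ∧ ∃ Δk : Fld M →ₗ[ℝ] Fld M,
    (∀ B B' : Fld M, inner ℝ (Δk B) B' = inner ℝ B (Δk B')) ∧
      ∀ B : Fld M, iterST L M k (fun A => Real.exp (-action1 A)) B = Z * Real.exp (-S1 M Δk B)

/-- consistency of the typings: at `k = 1`, `(ST)e^{−S} = S[(1.12)]`. [cite: Balaban1984PropagatorsI, (1.17) p.20] -/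
theorem iterST_one (ρ : Fld (towerM L M 1) → ℝ) : iterST L M 1 ρ = scaleDens L (rtT L M ρ) := rfl

omit hM in
/-- consistency: `AxAll 1` is the axial subspace of (1.10)/(1.12) (no condition on `QA`).
[cite: Balaban1984PropagatorsI, (1.17) p.20] -/
theorem axAll_one : AxAll L M 1 = Ax L M := by
  show Ax L M ⊓ (⊤ : Submodule ℝ (Fld M)).comap (Qlin L M) = Ax L M
  rw [Submodule.comap_top, inf_top_eq]

omit [NeZero L] hM in
/-- consistency: `Q₁ = Q`. [cite: Balaban1984PropagatorsI, (1.18) p.20] -/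
theorem qk_one : Qk L M 1 = Qlin L M := by
  show LinearMap.id ∘ₗ Qlin L M = Qlin L M
  rw [LinearMap.id_comp]

end Tower

/-! ## §5  Sect. C: the Faddeev–Popov identity (1.22) and the change of gauge (1.23) — typed CLAIMS -/

section FaddeevPopov

variable {d : ℕ} (L : ℕ) (M : Fin d → ℕ) [NeZero L] [hM : ∀ μ, NeZero (M μ)]

/-- «⟨∂*A, ∂*A⟩» of (1.21) on level `k` of the tower: `Σ_{x∈T_η} η^d |(∂*A)(x)|²`, `∂*A = Σ_μ ∂*_μA_μ` the divergence
(the tree's `B5Action121.divS`, adjoint differences at lattice factor `η⁻¹ = L^k`).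
[cite: Balaban1984PropagatorsI, (1.21) p.21] -/
def divSq (k : ℕ) (A : Fld (towerM L M k)) : ℝ :=
  ∑ x : Tor (towerM L M k), eta L k ^ d * ‖divS (towerM L M k) ((L : ℂ) ^ k) (cplx A) x‖ ^ 2

/-- the gauge transformation «A^λ = A − ∂^ηλ» ((1.4) at lattice factor `η⁻¹ = L^k`, (1.20)) of a REAL field by a real
gauge function: `A^λ_ν(x) = A_ν(x) − L^k(λ(x + ηe_ν) − λ(x))`. [cite: Balaban1984PropagatorsI, (1.20) p.20] -/
def gaugeR (k : ℕ) (A : Fld (towerM L M k)) (l : Scl (towerM L M k)) : Fld (towerM L M k) :=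
  WithLp.toLp 2 fun i => A i - (L : ℝ) ^ k * (l (i.1 + unitVec (towerM L M k) i.2) - l i.1)

/-- DICTIONARY: `gaugeR` is the tree's `B5Action121.gaugeT` on the complexified field.
[cite: Balaban1984PropagatorsI, (1.4) p.18] -/
theorem cplx_gaugeR (k : ℕ) (A : Fld (towerM L M k)) (l : Scl (towerM L M k)) :
    cplx (gaugeR L M k A l) = gaugeT (towerM L M k) ((L : ℂ) ^ k) (cplx A) (cplxS l) := by
  funext i
  obtain ⟨x, ν⟩ := i
  simp only [cplx, cplxS, gaugeR, gaugeT, PiLp.toLp_apply, Pi.sub_apply, B5Action121.GradOp_mulVec,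
    B5Action121.sdiff_mulVec]
  push_cast
  ring

/-- **The Faddeev–Popov integral of (1.22)**: «∫dλ δ(Q′_kλ) exp(−(1/2α)⟨∂*A^λ, ∂*A^λ⟩)» — the δ-integral (§1) over
the subspace `N(Q′_k)` of gauge functions (no further gauge condition: `G = ⊤`) of the Feynman-type weight of the
transformed field. [cite: Balaban1984PropagatorsI, (1.22) p.21] -/
def fp22 (k : ℕ) (α : ℝ) (A : Fld (towerM L M k)) : ℝ :=
  deltaInt (Qsk L M k) ⊤ (fun l => Real.exp (-(1 / (2 * α)) * divSq L M k (gaugeR L M k A l))) 0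

/-- **(1.22) CLAIM** p. 21 [PDF 5], verbatim: *"we introduce under the integral (1.17) the identity
1 = ∫dλ′ δ(Q′_kλ′) exp(−(1/2α)⟨∂*A^{λ′}, ∂*A^{λ′}⟩) / ∫dλ δ(Q′_kλ) exp(−(1/2α)⟨∂*A^λ, ∂*A^λ⟩). (1.22) … Next we will
calculate the expression in the numerator and denominator above and we will see that it is different from 0"* — the
content of the displayed identity is the non-vanishing of the Faddeev–Popov integral, typed as such. Proof deferred
((1.24)–(1.28)). [cite: Balaban1984PropagatorsI, (1.22) p.21] -/
def Claim122 (k : ℕ) (α : ℝ) : Prop := ∀ A : Fld (towerM L M k), fp22 L M k α A ≠ 0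

/-- **The right-hand side of (1.23)** without its numerical factor: «∫dA δ(B − Q_kA) exp(−(1/2α)⟨∂*A, ∂*A⟩)
(∫dλ δ(Q′_kλ) exp(−(1/2α)⟨∂*A^λ, ∂*A^λ⟩))^{−1} e^{−S^η(A)}» — the axial δ-functions are gone; the δ-integral runs over
the whole hyperplane `{A : Q_kA = B}` (`G = ⊤`). [cite: Balaban1984PropagatorsI, (1.23) p.21] -/
def rt23 (k : ℕ) (α : ℝ) : Fld M → ℝ :=
  deltaInt (Qk L M k) ⊤ fun A =>
    Real.exp (-(1 / (2 * α)) * divSq L M k A) * (fp22 L M k α A)⁻¹ * Real.exp (-actionEta L M k A)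

/-- **(1.23) CLAIM** p. 21 [PDF 5], verbatim: *"We change the order of integrations ∫dA∫dλ′…, and we make the gauge
transformation −λ′ in the integral ∫dA…. We change the order of integrations again and we make a translation λ → λ + λ′
in the integral ∫dλ…. We get (1.17) = z^{(k)}∫dAδ(B − Q_kA)(∫dλ′δ(Q′_kλ′)·δ_Ax(Q_{k−1}A + ∂^{L^{−1}}Q′_{k−1}λ′)·…·δ_Ax(A
+ ∂^ηλ′))·exp(−(1/2α)⟨∂*A, ∂*A⟩)(∫dλδ(Q′_kλ)exp(−(1/2α)⟨∂*A^λ, ∂*A^λ⟩))^{−1} e^{−S^η(A)} = z′^{(k)}∫dAδ(B −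
Q_kA)exp(−(1/2α)⟨∂*A, ∂*A⟩)·(∫dλδ(Q′_kλ)exp(−(1/2α)⟨∂*A^λ, ∂*A^λ⟩))^{−1} e^{−S^η(A)}. (1.23)"* — typed reading: for
every α > 0 the k-fold transformation `((ST)^k e^{−S})(B)` (the left-hand side of (1.17)) equals `z′^{(k)}·rt23 k α B`
for a constant `z′^{(k)} > 0`.  The middle expression (the λ′-integral of the axial δ-functions being a constant) is
the hierarchical-gauge lemma typed abstractly as `B5.HierGauge.complete/unique`; it is not separately transcribed
here.  Proof deferred. [cite: Balaban1984PropagatorsI, (1.23) p.21] -/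
def Eq123 (k : ℕ) : Prop :=
  ∀ α : ℝ, 0 < α → ∃ z' : ℝ, 0 < z' ∧
    ∀ B : Fld M, iterST L M k (fun A => Real.exp (-action1 A)) B = z' * rt23 L M k α B

/-- bookkeeping: under (1.17), (1.23) is the statement that the two fibre integrals `rt17` (axial δ's) and `rt23`
(Faddeev–Popov weight) are proportional. [cite: Balaban1984PropagatorsI, (1.23) p.21] -/
theorem eq123_of_eq117 (k : ℕ) (h117 : Eq117 L M k)
    (h : ∀ α : ℝ, 0 < α → ∃ c : ℝ, 0 < c ∧ ∀ B : Fld M, rt17 L M k B = c * rt23 L M k α B) : Eq123 L M k := by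
  intro α hα
  obtain ⟨z, hz, hzB⟩ := h117
  obtain ⟨c, hc, hcB⟩ := h α hα
  refine ⟨z * c, mul_pos hz hc, fun B => ?_⟩
  rw [hzB B, hcB B, mul_assoc]

end FaddeevPopov

end

end Literature.MathematicalPhysics.QuantumFieldTheory.Balaban1983to89.B5SectBStatements
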